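import Literature.NumberTheory.EllipticCurves.IsogenyFormulaCert
import Literature.NumberTheory.EllipticCurves.IsogenyFormulaDegree
import Literature.NumberTheory.DiophantineGeometry.GenEllValuationMultiplicity
import Summits.BirchSwinnertonDyer.Rank1Residual.Partition.EisensteinKernelTypeMultiplicative
import Summits.BirchSwinnertonDyer.Rank1Residual.Partition.GreenbergVatsalIsogenyClassPeriod
import HarnessLib

/-!
# Crux 3 `MazurMCOnCellB` (stmt-BirchSwinnertonDyer-19033), line `twistback` v12 — the KERNEL-POLYNOMIAL CERTIFICATE of the Galois side
# at an odd multiplicative prime `p`: from a kernel-decided `PolyCert.IsogenyCert` `φ : E → E′` of degree `p` (Bezout list certificate for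
# `(U, h) = 1`) to `E[p]` reducible, a rational `p`-line `Φ = ker φ ∩ E[p]` with a point `P = (x, y)`, `h(x) = 0`, and — when `h` is MONIC INTEGRAL and
# `Ψ₂Sq > 0` at the real roots of `h` — `¬ GVPar E p` (unramified ∧ even line ⇒ type A), WITHOUT any rational `p`-torsion point or twist

Width seat bsd-line-x2-p1-w5 (gen 6), cell `bsd-eis` (run/shared/lean/pub/bsd-eis/), 2026-08-29; `--supports stmt-BirchSwinnertonDyer-19033 --as helper`.
THEOREMS ONLY (no `def`, no named fact, no `sorry`, no instance). Generic in the curve and in `p`; consumed by this seat's per-class files for the 12 X2b-at-`5`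
classes whose unramified isogeny character is an even QUARTIC character (mod-`5` image `5B`, Sutherland; census `CENSUS-P5-NOTORSION-w5g6.md` on -19033):
there no quadratic twist has a rational `5`-torsion point, so neither `X2.not_gvPar_of_nsmul_eq_zero_of_mult` (w5/w8 atlases) nor the even-twist
certificate `X2.not_gvPar_of_twist_pos_of_nsmul_eq_zero_of_mult` (this seat's `…EvenTwistP5Atlas*`) applies; x2-p1-w5 g5 named this as the missing
«kernel reducibility certificate from an explicit 5-isogeny kernel polynomial» (HANDOFF «w5 g5 FINAL», NEXT (i)/(ii)). The same theorems serve `p = 7, 13`.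

CONTENT.
* §1 `isCoprime_ofList_of_bezout`: a LIST Bezout certificate `A·U + B·h = D` (`D ≠ 0`, checked by `decide` through `PolyCert.isZeroL`) gives
  `IsCoprime (ofList U) (ofList h)` in `K[X]` (`char K = 0`).
* §2 `degree_toIsogeny_of_bezout`: for a checked `IsogenyCert c` between `W₁, W₂`, the isogeny `(c.toFormula …).toIsogeny` has degree (`= #ker`, the
  tree's `Isogeny.degree`) `natDegree (ofList c.U)` (the tree's `IsogenyFormula.degree_toIsogeny`, Silverman III.4.10 + Remark III.4.13.3), `= p` when
  `c.U` has `p + 1` entries (`natDegree_ofList_eq`).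
* §3 `not_hasIrreducibleModPGaloisRep_of_isogenyCert`: `E[p]` is reducible (a `ℚ`-isogeny of prime degree `p`; `GVPeriod.isRationalLine_ker_inf_torsion`).
* §4 `exists_line_point_of_isogenyCert`: the rational `p`-line `Φ = ker φ ∩ E[p]` and a point `P ∈ Φ`, `P ≠ O`, `P = (x, y)` with `h(x) = 0` (off `h = 0`
  the isogeny is given by the formula and does not vanish, `IsogenyFormula.toIsogeny_some`).
* §5 `valuation_le_one_of_root_ofList_monic`: a root in `ℚ̄` of a MONIC integer-coefficient `ofList h` is integral at the chosen place over `p`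
  ([GenEll] Prop. 1.6 engine `valuation_le_one_of_isRoot`).
* §6 `not_gvPar_of_isogenyCert_of_forall_real_root_pos`: at a globally minimal `W₁` with multiplicative reduction at the odd prime `p`, the data of §2–§5
  plus `Ψ₂Sq(r) > 0` at every real root `r` of `h` give `¬ GVPar W₁ p` — the tree's Tate-free decision
  `KernelDisc.not_gvPar_of_valuation_le_one_of_forall_real_root_pos_of_mult` (unramified ∧ even ⇒ co-type ⇒ type A, Greenberg–Vatsal Thm. (1.3), §2 p. 28).
* §7 `aeval_ofList_quadratic`, `aeval_Ψ₂Sq_real`, `Ψ₂Sq_pos_of_quadratic_root_of_lt` / `_of_gt`: the real-root sign certificate for a QUADRATIC kernel polynomial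
  `X² + sX + q`: on its roots `Ψ₂Sq(r) = α·(r − t₀)` with `α = 4(s² − q) − b₂s + 2b₄`, `αt₀ = −(4sq − b₂q + b₆)`, and `t₀` lies left (resp. right) of both
  roots iff `t₀² + st₀ + q > 0` and `2t₀ + s < 0` (resp. `> 0`) — four rational inequalities closed by `norm_num` per curve.

HONEST FRAMING: pure algebra / bookkeeping on top of the tree's isogeny-formula, degree and Greenberg–Vatsal-type theories; nothing about any `L`-value,
Selmer group, main conjecture or BSD is asserted; closes no stub; nothing is booked; 0 cells / labels / stubs / tiers move; no summit statement / Mazur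
MC / BSD is proved for any curve.

References: [SilvermanAEC2009] Thm. III.4.8, III.4.10, Remark III.4.13.3, Cor. III.6.4(b); [Velu1971]; [GreenbergVatsal2000] Thm. (1.3), §2 p. 28;
[MochizukiGenEll2010] Prop. 1.6 (root integrality); [SerreInventiones1972] §1.11–1.12.
-/

set_option autoImplicit false
-- `Summit.BirchSwinnertonDyer.BirchSwinnertonDyer.…`: the summit and its single sub-problem share a name.
set_option linter.dupNamespace false

noncomputable section

open scoped Classical
open WeierstrassCurve Polynomial Literature.NumberTheory.EllipticCurves Literature.NumberTheory.EllipticCurves.PolyCert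
  Literature.NumberTheory.EllipticCurves.Rank1Residual Literature.NumberTheory.GaloisRepresentations Field
  Summit.BirchSwinnertonDyer.Rank1Residual

namespace Summit.BirchSwinnertonDyer.BirchSwinnertonDyer.Theorems.EisensteinPrimesKernelIsogenyCertificateType

/-! ## §1 Coprimality from a list Bezout certificate -/

/-- **`A·U + B·h = D ≠ 0` as integer lists ⇒ `(U, h) = 1` in `K[X]`** (`char K = 0`): divide by `D`. The hypothesis is a closed `Bool`
(`PolyCert.isZeroL`) meant for `decide`. [folklore] -/
theorem isCoprime_ofList_of_bezout {K : Type*} [Field K] [CharZero K] (U h A B : List ℤ) (D : ℤ) (hD : D ≠ 0)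
    (hz : isZeroL (subL (addL (mulL A U) (mulL B h)) [D]) = true) :
    IsCoprime (ofList U : K[X]) (ofList h) := by
  have H := ofList_eq_zero_of_isZeroL (R := K) _ hz
  rw [ofList_subL, ofList_addL, ofList_mulL, ofList_mulL, ofList_cons, ofList_nil, mul_zero, add_zero,
    sub_eq_zero] at H
  have hDK : (D : K) ≠ 0 := by exact_mod_cast hD
  refine ⟨C ((D : K)⁻¹) * ofList A, C ((D : K)⁻¹) * ofList B, ?_⟩
  rw [mul_assoc, mul_assoc, ← mul_add, H, ← C_mul, inv_mul_cancel₀ hDK, C_1]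

/-- `natDegree (ofList l) = l.length − 1` when the last entry is nonzero. [folklore] -/
theorem natDegree_ofList_eq {K : Type*} [Field K] [CharZero K] (l : List ℤ) (h : coeffL l (l.length - 1) ≠ 0) :
    (ofList l : K[X]).natDegree = l.length - 1 :=
  le_antisymm (natDegree_ofList_le l) (le_natDegree_ofList l _ h)

/-! ## §2 The degree of a certified isogeny -/

variable {W₁ W₂ : WeierstrassCurve ℚ} [W₁.IsElliptic] [W₂.IsElliptic]

/-- **`deg φ = deg U` for a kernel-decided certificate with `(U, h) = 1`**: the tree's `IsogenyFormula.degree_toIsogeny` (Silverman III.4.10(a),(c) +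
Remark III.4.13.3: `#ker φ = [K̄(E₁) : φ^*K̄(E₂)] = deg U`) fed with §1 mapped to `ℚ̄[X]`.
[cite: SilvermanAEC2009, Thm. III.4.10 and Remark III.4.13.3] -/
theorem degree_toIsogeny_of_bezout (c : IsogenyCert) (hc : c.check = true)
    (h₁ : W₁ = ⟨c.a₁, c.a₂, c.a₃, c.a₄, c.a₆⟩) (h₂ : W₂ = ⟨c.a₁', c.a₂', c.a₃', c.a₄', c.a₆'⟩)
    (A B : List ℤ) (D : ℤ) (hD : D ≠ 0) (hz : isZeroL (subL (addL (mulL A c.U) (mulL B c.h)) [D]) = true) :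
    (c.toFormula hc W₁ W₂ h₁ h₂).toIsogeny.degree = (ofList c.U : ℚ[X]).natDegree := by
  refine (c.toFormula hc W₁ W₂ h₁ h₂).degree_toIsogeny ?_
  have hcop := (isCoprime_ofList_of_bezout (K := ℚ) c.U c.h A B D hD hz).map
    (Polynomial.mapRingHom (algebraMap ℚ (AlgebraicClosure ℚ)))
  change IsCoprime ((ofList c.U : ℚ[X]).map (algebraMap ℚ (AlgebraicClosure ℚ)))
    ((ofList c.h : ℚ[X]).map (algebraMap ℚ (AlgebraicClosure ℚ)))
  simpa only [Polynomial.coe_mapRingHom] using hcop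

/-- **`deg φ = p`** when moreover `U` is listed with `p + 1` entries (last one nonzero by `check`). [cite: SilvermanAEC2009, Thm. III.4.10 and Remark III.4.13.3] -/
theorem degree_toIsogeny_eq_of_bezout (c : IsogenyCert) (hc : c.check = true)
    (h₁ : W₁ = ⟨c.a₁, c.a₂, c.a₃, c.a₄, c.a₆⟩) (h₂ : W₂ = ⟨c.a₁', c.a₂', c.a₃', c.a₄', c.a₆'⟩)
    (A B : List ℤ) (D : ℤ) (hD : D ≠ 0) (hz : isZeroL (subL (addL (mulL A c.U) (mulL B c.h)) [D]) = true)
    {p : ℕ} (hlen : c.U.length = p + 1) :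
    (c.toFormula hc W₁ W₂ h₁ h₂).toIsogeny.degree = p := by
  rw [degree_toIsogeny_of_bezout c hc h₁ h₂ A B D hD hz, natDegree_ofList_eq c.U, hlen, Nat.add_sub_cancel]
  rw [hlen, Nat.add_sub_cancel]
  have := (IsogenyCert.check_spec hc).2.2.2.1
  rwa [hlen, Nat.add_sub_cancel] at this

/-! ## §3 Reducibility of `E[p]` -/

/-- **A kernel-decided isogeny certificate of prime degree `p` makes `E[p]` reducible** — `ker φ` has `p` points while `#E[p] = p²`, so some `p`-torsion
point survives and `ker φ ∩ E[p]` is a rational `p`-line (`GVPeriod.isRationalLine_ker_inf_torsion`). NO rational `p`-torsion point and NO twist is used.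
[cite: SilvermanAEC2009, Thm. III.4.10 and Cor. III.6.4(b)] [cite: GreenbergVatsal2000, p. 4 (rational p-isogeny kernels)] -/
theorem exists_isRationalLine_of_isogenyCert {p : ℕ} [Fact p.Prime] (c : IsogenyCert) (hc : c.check = true)
    (h₁ : W₁ = ⟨c.a₁, c.a₂, c.a₃, c.a₄, c.a₆⟩) (h₂ : W₂ = ⟨c.a₁', c.a₂', c.a₃', c.a₄', c.a₆'⟩)
    (A B : List ℤ) (D : ℤ) (hD : D ≠ 0) (hz : isZeroL (subL (addL (mulL A c.U) (mulL B c.h)) [D]) = true)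
    (hlen : c.U.length = p + 1) :
    IsRationalLine W₁ p ((c.toFormula hc W₁ W₂ h₁ h₂).toIsogeny.toAddMonoidHom.ker.comap (geomTorsion W₁ (p : ℤ)).subtype) := by
  have hp : p.Prime := Fact.out
  set φ := (c.toFormula hc W₁ W₂ h₁ h₂).toIsogeny with hφ
  have hdeg : φ.degree = p := degree_toIsogeny_eq_of_bezout c hc h₁ h₂ A B D hD hz hlen
  have hne : ∃ P : geomPoints W₁, P ∈ geomTorsion W₁ (p : ℤ) ∧ φ P ≠ 0 := by
    by_contra h
    push Not at h
    have hle : geomTorsion W₁ (p : ℤ) ≤ φ.toAddMonoidHom.ker := fun P hP ↦ by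
      rw [AddMonoidHom.mem_ker]; exact h P hP
    have hcard := AddSubgroup.card_le_of_le hle
    rw [Rank1Residual.natCard_geomTorsion W₁ p] at hcard
    change p ^ 2 ≤ φ.degree at hcard
    rw [hdeg] at hcard
    have : p < p ^ 2 := by
      calc p = p ^ 1 := (pow_one p).symm
        _ < p ^ 2 := Nat.pow_lt_pow_right hp.one_lt (by norm_num)
    omega
  exact GVPeriod.isRationalLine_ker_inf_torsion φ (hdeg ▸ dvd_rfl) hne

/-- **`E[p]` reducible from the certificate.** [cite: SilvermanAEC2009, Thm. III.4.10 and Cor. III.6.4(b)] -/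
theorem not_hasIrreducibleModPGaloisRep_of_isogenyCert {p : ℕ} [Fact p.Prime] (c : IsogenyCert) (hc : c.check = true)
    (h₁ : W₁ = ⟨c.a₁, c.a₂, c.a₃, c.a₄, c.a₆⟩) (h₂ : W₂ = ⟨c.a₁', c.a₂', c.a₃', c.a₄', c.a₆'⟩)
    (A B : List ℤ) (D : ℤ) (hD : D ≠ 0) (hz : isZeroL (subL (addL (mulL A c.U) (mulL B c.h)) [D]) = true)
    (hlen : c.U.length = p + 1) : ¬ W₁.HasIrreducibleModPGaloisRep p :=
  not_hasIrreducibleModPGaloisRep_of_isRationalLine (exists_isRationalLine_of_isogenyCert c hc h₁ h₂ A B D hD hz hlen)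

/-! ## §4 A kernel point with `h(x) = 0` -/

/-- **The line `ker φ ∩ E[p]` carries a point `P = (x, y) ≠ O` with `h(x) = 0`**: a line has `p ≥ 2` points; a nonzero point is affine; were `h(x) ≠ 0` the
isogeny would be given at `P` by the formula (`IsogenyFormula.toIsogeny_some`) with an AFFINE value, not `O`. [cite: SilvermanAEC2009, Thm. III.4.8 and Remark III.4.13.3] -/
theorem exists_line_point_of_isogenyCert {p : ℕ} [Fact p.Prime] (c : IsogenyCert) (hc : c.check = true)
    (h₁ : W₁ = ⟨c.a₁, c.a₂, c.a₃, c.a₄, c.a₆⟩) (h₂ : W₂ = ⟨c.a₁', c.a₂', c.a₃', c.a₄', c.a₆'⟩)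
    (A B : List ℤ) (D : ℤ) (hD : D ≠ 0) (hz : isZeroL (subL (addL (mulL A c.U) (mulL B c.h)) [D]) = true)
    (hlen : c.U.length = p + 1) :
    ∃ Φ : AddSubgroup (geomTorsion W₁ (p : ℤ)), IsRationalLine W₁ p Φ ∧ ∃ P ∈ Φ, P ≠ 0 ∧
      ∃ (x y : AlgebraicClosure ℚ) (hxy : (W₁.baseChange (AlgebraicClosure ℚ)).toAffine.Nonsingular x y),
        (P : W₁.geomPoints) = Affine.Point.some x y hxy ∧ aeval x (ofList c.h : ℚ[X]) = 0 := by
  have hp : p.Prime := Fact.out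
  set φF := c.toFormula hc W₁ W₂ h₁ h₂ with hφF
  set Φ := φF.toIsogeny.toAddMonoidHom.ker.comap (geomTorsion W₁ (p : ℤ)).subtype with hΦdef
  have hΦ : IsRationalLine W₁ p Φ := exists_isRationalLine_of_isogenyCert c hc h₁ h₂ A B D hD hz hlen
  refine ⟨Φ, hΦ, ?_⟩
  -- a nonzero element of `Φ` (`#Φ = p ≥ 2`)
  haveI : Finite Φ := Nat.finite_of_card_ne_zero (by rw [hΦ.1]; exact hp.ne_zero)
  obtain ⟨P, hPΦ, hP0⟩ : ∃ P ∈ Φ, P ≠ 0 := by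
    by_contra h
    push Not at h
    have hbot : Φ = ⊥ := (AddSubgroup.eq_bot_iff_forall _).mpr h
    have h1 : Nat.card Φ = 1 := by rw [hbot]; exact AddSubgroup.card_bot
    rw [hΦ.1] at h1
    exact hp.one_lt.ne' h1
  refine ⟨P, hPΦ, hP0, ?_⟩
  have hker : φF.toIsogeny (P : W₁.geomPoints) = 0 := by
    have := hPΦ
    rw [hΦdef, AddSubgroup.mem_comap, AddMonoidHom.mem_ker] at this
    exact this
  -- `P` is affine
  obtain ⟨Q, hQ⟩ := P
  rcases Q with _ | ⟨x, y, hxy⟩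
  · exact (hP0 rfl).elim
  refine ⟨x, y, hxy, rfl, ?_⟩
  by_contra hx
  have hx' : φF.geom.h.eval x ≠ 0 := by
    change ((ofList c.h : ℚ[X]).map (algebraMap ℚ (AlgebraicClosure ℚ))).eval x ≠ 0
    rwa [eval_map, ← aeval_def]
  have hval := φF.toIsogeny_some hxy hx'
  change φF.toIsogeny (Affine.Point.some x y hxy) = 0 at hker
  rw [hval] at hker
  exact absurd hker (by rintro ⟨⟩)

/-! ## §5 Integrality of a root of a monic integer polynomial at the place over `p` -/

/-- **A root in `ℚ̄` of a monic `ofList h` (integer coefficients) is integral at the chosen place `𝔓 ∣ p`**: `v_𝔓(x) ≤ 1` ([GenEll] Prop. 1.6: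
integral coefficients + unit leading coefficient). [cite: MochizukiGenEll2010, Prop 1.6 p.10] -/
theorem valuation_le_one_of_root_ofList_monic (p : ℕ) [Fact p.Prime] (l : List ℤ) (hmonic : coeffL l (l.length - 1) = 1)
    {x : AlgebraicClosure ℚ} (hx : aeval x (ofList l : ℚ[X]) = 0) :
    (placeOver p).valuation x ≤ 1 := by
  have h1 : coeffL l (l.length - 1) ≠ 0 := by rw [hmonic]; exact one_ne_zero
  set F : (AlgebraicClosure ℚ)[X] := (ofList l : ℚ[X]).map (algebraMap ℚ (AlgebraicClosure ℚ)) with hF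
  have hcoeff : ∀ n, F.coeff n = ((coeffL l n : ℤ) : AlgebraicClosure ℚ) := fun n ↦ by
    rw [hF, coeff_map, coeff_ofList, map_intCast]
  refine Literature.NumberTheory.DiophantineGeometry.GenEll.valuation_le_one_of_isRoot ((placeOver p).valuation) (p := F)
    (fun n ↦ ?_) ?_ ?_
  · rw [hcoeff]; exact ((placeOver p).valuation_le_one_iff _).mpr (intCast_mem _ _)
  · have hdeg : F.natDegree = l.length - 1 := by
      rw [hF, natDegree_map_eq_of_injective (algebraMap ℚ (AlgebraicClosure ℚ)).injective, natDegree_ofList_eq l h1]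
    rw [leadingCoeff, hdeg, hcoeff, hmonic, Int.cast_one, map_one]
  · rw [IsRoot, hF, eval_map, ← aeval_def, hx]

/-! ## §6 `¬ GVPar` from the certificate: unramified ∧ even line at an odd multiplicative prime -/

/-- **Type A by a kernel-polynomial certificate** (globally minimal `W₁`, odd MULTIPLICATIVE `p`): a checked `IsogenyCert` of degree `p` (Bezout lists
`A, B, D`; `U` with `p + 1` entries) whose kernel polynomial `h` is MONIC with integer coefficients (so every kernel abscissa is `𝔓`-integral: the line is
UNRAMIFIED at `p`, `KernelDisc.lineUnramifiedAt_of_valuation_le_one_of_mult`) and such that `Ψ₂Sq(r) > 0` at every real root `r` of `h` (the kernel points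
are REAL: the line is EVEN) gives `¬ GVPar W₁ p` — one co-type line forces type A at an odd multiplicative prime (Greenberg–Vatsal Thm. (1.3), §2 p. 28; the
tree's Tate-free `KernelDisc.not_gvPar_of_valuation_le_one_of_forall_real_root_pos_of_mult`). [cite: GreenbergVatsal2000, Thm. (1.3) and §2 p. 28] -/
theorem not_gvPar_of_isogenyCert_of_forall_real_root_pos [W₁.IsGloballyMinimal] {p : ℕ} [Fact p.Prime] (hp2 : p ≠ 2)
    (hmult : W₁.HasMultiplicativeReductionAtPrime p) (c : IsogenyCert) (hc : c.check = true)
    (h₁ : W₁ = ⟨c.a₁, c.a₂, c.a₃, c.a₄, c.a₆⟩) (h₂ : W₂ = ⟨c.a₁', c.a₂', c.a₃', c.a₄', c.a₆'⟩)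
    (A B : List ℤ) (D : ℤ) (hD : D ≠ 0) (hz : isZeroL (subL (addL (mulL A c.U) (mulL B c.h)) [D]) = true)
    (hlen : c.U.length = p + 1) (hmonic : coeffL c.h (c.h.length - 1) = 1)
    (hpos : ∀ r : ℝ, aeval r (ofList c.h : ℚ[X]) = 0 → 0 < aeval r W₁.Ψ₂Sq) : ¬ GVPar W₁ p := by
  obtain ⟨Φ, hΦ, P, hPΦ, hP0, x, y, hxy, hP, hx⟩ := exists_line_point_of_isogenyCert c hc h₁ h₂ A B D hD hz hlen
  exact KernelDisc.not_gvPar_of_valuation_le_one_of_forall_real_root_pos_of_mult hΦ hp2 hmult hPΦ hP0 hP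
    (valuation_le_one_of_root_ofList_monic p c.h hmonic hx) hx hpos

/-! ## §7 The real-root sign certificate for a quadratic kernel polynomial -/

/-- `aeval r (ofList [q, s, 1]) = r² + s·r + q` over `ℝ`. [folklore] -/
theorem aeval_ofList_quadratic (q s : ℤ) (r : ℝ) : aeval r (ofList [q, s, 1] : ℚ[X]) = r ^ 2 + s * r + q := by
  simp only [ofList_cons, ofList_nil, map_add, map_mul, aeval_C, aeval_X, mul_zero, add_zero, Int.cast_one,
    eq_ratCast, Rat.cast_intCast, Rat.cast_one]
  ring

/-- `aeval r Ψ₂Sq = 4r³ + b₂r² + 2b₄r + b₆` over `ℝ` for a curve over `ℚ`. [folklore] -/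
theorem aeval_Ψ₂Sq_real (W : WeierstrassCurve ℚ) (r : ℝ) :
    aeval r W.Ψ₂Sq = 4 * r ^ 3 + (W.b₂ : ℝ) * r ^ 2 + 2 * (W.b₄ : ℝ) * r + (W.b₆ : ℝ) := by
  simp only [WeierstrassCurve.Ψ₂Sq, map_add, map_mul, aeval_C, aeval_X, map_pow, eq_ratCast, Rat.cast_ofNat]

/-- **Left certificate**: if `α := 4(s² − q) − b₂s + 2b₄ > 0`, `αt₀ + (4sq − b₂q + b₆) = 0`, `t₀² + st₀ + q > 0` and `2t₀ + s < 0` (so `t₀` lies left of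
both roots), then `4r³ + b₂r² + 2b₄r + b₆ = α(r − t₀) > 0` at every root `r` of `X² + sX + q`. [folklore] -/
theorem Ψ₂Sq_pos_of_quadratic_root_of_lt {s q b₂ b₄ b₆ t₀ : ℝ} (hα : 0 < 4 * (s ^ 2 - q) - b₂ * s + 2 * b₄)
    (ht₀ : (4 * (s ^ 2 - q) - b₂ * s + 2 * b₄) * t₀ + (4 * s * q - b₂ * q + b₆) = 0)
    (h1 : 0 < t₀ ^ 2 + s * t₀ + q) (h2 : 2 * t₀ + s < 0) {r : ℝ} (hr : r ^ 2 + s * r + q = 0) :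
    0 < 4 * r ^ 3 + b₂ * r ^ 2 + 2 * b₄ * r + b₆ := by
  have hr3 : r ^ 3 = (s ^ 2 - q) * r + s * q := by linear_combination (r - s) * hr
  have hval : 4 * r ^ 3 + b₂ * r ^ 2 + 2 * b₄ * r + b₆ = (4 * (s ^ 2 - q) - b₂ * s + 2 * b₄) * (r - t₀) := by
    linear_combination 4 * hr3 + b₂ * hr + ht₀
  have hrt : t₀ < r := by
    by_contra hle
    push Not at hle
    -- `h(t₀) − h(r) = (t₀ − r)(t₀ + r + s) ≤ 0`, contradiction
    nlinarith [mul_nonneg (sub_nonneg.mpr hle) (by linarith : (0 : ℝ) ≤ -(t₀ + r + s))]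
  rw [hval]
  exact mul_pos hα (sub_pos.mpr hrt)

/-- **Right certificate**: if `α < 0`, `αt₀ + (4sq − b₂q + b₆) = 0`, `t₀² + st₀ + q > 0` and `2t₀ + s > 0` (so `t₀` lies right of both roots), then
`4r³ + b₂r² + 2b₄r + b₆ = α(r − t₀) > 0` at every root. [folklore] -/
theorem Ψ₂Sq_pos_of_quadratic_root_of_gt {s q b₂ b₄ b₆ t₀ : ℝ} (hα : 4 * (s ^ 2 - q) - b₂ * s + 2 * b₄ < 0)
    (ht₀ : (4 * (s ^ 2 - q) - b₂ * s + 2 * b₄) * t₀ + (4 * s * q - b₂ * q + b₆) = 0)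
    (h1 : 0 < t₀ ^ 2 + s * t₀ + q) (h2 : 0 < 2 * t₀ + s) {r : ℝ} (hr : r ^ 2 + s * r + q = 0) :
    0 < 4 * r ^ 3 + b₂ * r ^ 2 + 2 * b₄ * r + b₆ := by
  have hr3 : r ^ 3 = (s ^ 2 - q) * r + s * q := by linear_combination (r - s) * hr
  have hval : 4 * r ^ 3 + b₂ * r ^ 2 + 2 * b₄ * r + b₆ = (4 * (s ^ 2 - q) - b₂ * s + 2 * b₄) * (r - t₀) := by
    linear_combination 4 * hr3 + b₂ * hr + ht₀
  have hrt : r < t₀ := by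
    by_contra hle
    push Not at hle
    nlinarith [mul_nonneg (sub_nonneg.mpr hle) (by linarith : (0 : ℝ) ≤ t₀ + r + s)]
  rw [hval]
  exact mul_pos_of_neg_of_neg hα (sub_neg.mpr hrt)

end Summit.BirchSwinnertonDyer.BirchSwinnertonDyer.Theorems.EisensteinPrimesKernelIsogenyCertificateType

end
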